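import Summits.CriticalPhenomena.PercolationContinuityZ3.Theorems.PercNearOneGluingNoHeavyLowerTailSahiCombTriWAndPerfect4Cols

/-!
# AND with the perfect4 block, part 3: `P₁ ∧ perfect4` is an intersecting Kleitman shell whenever `P₁` is

Support file of the one-cut programme (crux `NoHeavyLowerTail`, stmt-CriticalPhenomena-4575; unit `prim-lf-1` gen 57, memo
`FROM-prim-lf-1-gen57-PERFECT4.md`).  `perfect4 = x₀(x₁ ∨ x₂ ∨ x₃) ∨ x₁x₂x₃ ⊆ 2^{Fin 4}` is the self-dual block that resisted every symbol
certificate of gens 43–55; the four-term certificate used here was found by the complete local-certificate LP of gen 57 (max-flow pricing of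
unit words over all 7 581 fibre configurations, complete non-negative remainder) and verified there in exact arithmetic.
* `corP_andProd_perfect4_eq`: row decomposition `Cor_{P₁ ∧ perfect4}(A,B) = Σ_{x∈P₁}[uu' + gg' + Σ_a T_aT'_a + Σ_a p_ap'_a]`;
* **`corP_andProd_perfect4_nonneg`**: `Cor_{P₁ ∧ perfect4}(A,B) ≥ 0` for every antipode-free up-set `P₁` with `Cor_{P₁} ≥ 0` and all up-sets
  `A, B` of `2^{γ₁ ⊕ Fin 4}`; `…_of_klShell`; **`klShell_andProd_perfect4`**: the AND-product is an intersecting Kleitman shell.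
Proof: pointwise, `rearr3` (part `…AndMaj3Cols`) bounds `Σ_a p_ap'_a`, `Σ_a T_aT'_a` below by the anti-aligned products of the sorted profiles; the
Profile Lemma (part 1) bounds that below by `½S₂S₂' + ½S₃S₃' + (MF'+FM') + (uE'+Eu')`; the six words are increasing with the pair condition
(part 2), so `sum_mul_nonneg_of_unit/_of_two` (goodness of `P₁`) makes every summed product non-negative.
HONEST LABEL: complete proof, standard axioms.  Closes the perfect4 case of `AndShellLower` (intersecting half): together with the landed block
theorems (cubes/cylinders, maj3, claw, clawPlus, …) EVERY block on ≤ 4 variables is now covered. [this work]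
-/

namespace Summit.CriticalPhenomena.PercolationContinuityZ3.Theorems

namespace FiveUpSet

open Finset Perfect4Cert

variable {γ₁ : Type} [DecidableEq γ₁] [Fintype γ₁]

/-! ### Row decomposition and the theorem -/

/-- **Row decomposition**: `Cor_{P₁ ∧ perfect4}(A,B) = Σ_{x∈P₁}[uu' + gg' + Σ_a T_aT'_a + Σ_a p_ap'_a]`. [this work] -/
theorem corP_andProd_perfect4_eq (P₁ : Finset (Finset γ₁)) (A B : Finset (Finset (γ₁ ⊕ Fin 4))) :
    corP (andProd P₁ perfect4) A B = ∑ x ∈ P₁, (cU A x * cU B x + cG A x * cG B x + ∑ i : Fin 3, cT A i x * cT B i x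
      + ∑ i : Fin 3, cP A i x * cP B i x) := by
  rw [corP_eq_sum, andProd_eq_biUnion, sum_biUnion (pairwiseDisjoint_rows P₁ perfect4)]
  refine sum_congr rfl fun x _ => ?_
  rw [sum_map, sum_perfect4]
  unfold cU cG cT cP p4col
  simp only [rowEmb_apply]

/-- **THEOREM (AND with the perfect4 block).**  If `P₁` is an antipode-free up-set with `Cor_{P₁} ≥ 0` on all pairs of up-sets, then
`Cor_{P₁ ∧ perfect4}(A,B) ≥ 0` for all up-sets `A, B` of the product cube `2^{γ₁ ⊕ Fin 4}`. [this work] -/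
theorem corP_andProd_perfect4_nonneg {P₁ : Finset (Finset γ₁)} (hP : IsUpperSet (P₁ : Set (Finset γ₁))) (hd : Disjoint P₁ (refl P₁))
    (hcor : ∀ U V : Finset (Finset γ₁), IsUpperSet (U : Set (Finset γ₁)) → IsUpperSet (V : Set (Finset γ₁)) → 0 ≤ corP P₁ U V)
    {A B : Finset (Finset (γ₁ ⊕ Fin 4))} (hA : IsUpperSet (A : Set (Finset (γ₁ ⊕ Fin 4)))) (hB : IsUpperSet (B : Set (Finset (γ₁ ⊕ Fin 4)))) :
    0 ≤ corP (andProd P₁ perfect4) A B := by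
  rw [corP_andProd_perfect4_eq]
  -- pointwise: rearrangement on the two triples + the Profile Lemma (part 1)
  have key : ∀ x ∈ P₁, wS2 A x * wS2 B x + wS3 A x * wS3 B x + 2 * (wM A x * wFx B x) + 2 * (wFx A x * wM B x)
      + 2 * (cU A x * wEx B x) + 2 * (wEx A x * cU B x)
      ≤ 2 * (cU A x * cU B x + cG A x * cG B x + ∑ i : Fin 3, cT A i x * cT B i x + ∑ i : Fin 3, cP A i x * cP B i x) := by
    intro x _
    obtain ⟨uA, gA, hiA⟩ := cols_bounds (A := A) x
    obtain ⟨uB, gB, hiB⟩ := cols_bounds (A := B) x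
    have hA0 := hiA 0; have hA1 := hiA 1; have hA2 := hiA 2; have hB0 := hiB 0; have hB1 := hiB 1; have hB2 := hiB 2
    have hrP : pMin A x * pMax B x + pMed A x * pMed B x + pMax A x * pMin B x
        ≤ cP A 0 x * cP B 0 x + cP A 1 x * cP B 1 x + cP A 2 x * cP B 2 x := by
      unfold pMed pMin pMax
      exact rearr3 _ _ _ _ _ _ hA0.1.1 hA0.1.2 hA1.1.1 hA1.1.2 hA2.1.1 hA2.1.2
    have hrT : tMin A x * tMax B x + tMed A x * tMed B x + tMax A x * tMin B x
        ≤ cT A 0 x * cT B 0 x + cT A 1 x * cT B 1 x + cT A 2 x * cT B 2 x := by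
      unfold tMed tMin tMax
      exact rearr3 _ _ _ _ _ _ hA0.2.1 hA0.2.2 hA1.2.1 hA1.2.2 hA2.2.1 hA2.2.2
    obtain ⟨apm, apd, apM, atm, atd, atM⟩ := stats_bounds (A := A) x
    obtain ⟨bpm, bpd, bpM, btm, btd, btM⟩ := stats_bounds (A := B) x
    obtain ⟨as1, as2, as3, as4⟩ := stats_sorted (A := A) x
    obtain ⟨bs1, bs2, bs3, bs4⟩ := stats_sorted (A := B) x
    obtain ⟨ao1, ao2, ao3, ao4, ao5⟩ := stats_order hA x
    obtain ⟨bo1, bo2, bo3, bo4, bo5⟩ := stats_order hB x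
    have tri : ∀ z : ℤ, -1 ≤ z ∧ z ≤ 1 → z = -1 ∨ z = 0 ∨ z = 1 := fun z hz => by omega
    have hprof := profile_ineq (tri _ uA) (tri _ gA) (tri _ apm) (tri _ apd) (tri _ apM) (tri _ atm) (tri _ atd) (tri _ atM)
      (tri _ uB) (tri _ gB) (tri _ bpm) (tri _ bpd) (tri _ bpM) (tri _ btm) (tri _ btd) (tri _ btM)
      as1 as2 as3 as4 ao1 ao2 ao3 ao4 ao5 bs1 bs2 bs3 bs4 bo1 bo2 bo3 bo4 bo5
    simp only [rhs2, lhs2] at hprof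
    unfold wS2 wS3 wM wFx wEx
    rw [Fin.sum_univ_three, Fin.sum_univ_three]
    linarith [hprof, hrP, hrT]
  have hsum := sum_le_sum key
  rw [← mul_sum] at hsum
  have eqL : ∑ x ∈ P₁, (wS2 A x * wS2 B x + wS3 A x * wS3 B x + 2 * (wM A x * wFx B x) + 2 * (wFx A x * wM B x)
      + 2 * (cU A x * wEx B x) + 2 * (wEx A x * cU B x))
      = ∑ x ∈ P₁, wS2 A x * wS2 B x + ∑ x ∈ P₁, wS3 A x * wS3 B x + 2 * ∑ x ∈ P₁, wM A x * wFx B x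
        + 2 * ∑ x ∈ P₁, wFx A x * wM B x + 2 * ∑ x ∈ P₁, cU A x * wEx B x + 2 * ∑ x ∈ P₁, wEx A x * cU B x := by
    simp only [sum_add_distrib, ← mul_sum]
  rw [eqL] at hsum
  have bwA := fun x : Finset γ₁ => words_bounds (A := A) x
  have bwB := fun x : Finset γ₁ => words_bounds (A := B) x
  have t22 := sum_mul_nonneg_of_two hP hd hcor (wS2 A) (wS2 B) (fun x _ => (bwA x).1) (fun x _ => (bwB x).1)
    (fun x _ x' _ h => (words_mono hA h).1) (fun x _ x' _ h => (words_mono hB h).1)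
    (fun x _ x' _ h => (words_pair hA h).1) (fun x _ x' _ h => (words_pair hB h).1)
  have t33 := sum_mul_nonneg_of_two hP hd hcor (wS3 A) (wS3 B) (fun x _ => (bwA x).2.1) (fun x _ => (bwB x).2.1)
    (fun x _ x' _ h => (words_mono hA h).2.1) (fun x _ x' _ h => (words_mono hB h).2.1)
    (fun x _ x' _ h => (words_pair hA h).2.1) (fun x _ x' _ h => (words_pair hB h).2.1)
  have tMF := sum_mul_nonneg_of_unit hP hd hcor (wM A) (wFx B) (fun x _ => (bwA x).2.2.1) (fun x _ => (bwB x).2.2.2.1)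
    (fun x _ x' _ h => (words_mono hA h).2.2.1) (fun x _ x' _ h => (words_mono hB h).2.2.2.1)
    (fun x _ x' _ h => (words_pair hA h).2.2.1) (fun x _ x' _ h => (words_pair hB h).2.2.2.1)
  have tFM := sum_mul_nonneg_of_unit hP hd hcor (wFx A) (wM B) (fun x _ => (bwA x).2.2.2.1) (fun x _ => (bwB x).2.2.1)
    (fun x _ x' _ h => (words_mono hA h).2.2.2.1) (fun x _ x' _ h => (words_mono hB h).2.2.1)
    (fun x _ x' _ h => (words_pair hA h).2.2.2.1) (fun x _ x' _ h => (words_pair hB h).2.2.1)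
  have tUE := sum_mul_nonneg_of_unit hP hd hcor (cU A) (wEx B) (fun x _ => (bwA x).2.2.2.2.2) (fun x _ => (bwB x).2.2.2.2.1)
    (fun x _ x' _ h => (words_mono hA h).2.2.2.2.2) (fun x _ x' _ h => (words_mono hB h).2.2.2.2.1)
    (fun x _ x' _ h => (words_pair hA h).2.2.2.2.2) (fun x _ x' _ h => (words_pair hB h).2.2.2.2.1)
  have tEU := sum_mul_nonneg_of_unit hP hd hcor (wEx A) (cU B) (fun x _ => (bwA x).2.2.2.2.1) (fun x _ => (bwB x).2.2.2.2.2)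
    (fun x _ x' _ h => (words_mono hA h).2.2.2.2.1) (fun x _ x' _ h => (words_mono hB h).2.2.2.2.2)
    (fun x _ x' _ h => (words_pair hA h).2.2.2.2.1) (fun x _ x' _ h => (words_pair hB h).2.2.2.2.2)
  linarith

/-- The same theorem with the hypothesis in Kleitman-shell form. [this work] -/
theorem corP_andProd_perfect4_nonneg_of_klShell {P₁ : Finset (Finset γ₁)} (hP : IsUpperSet (P₁ : Set (Finset γ₁)))
    (hd : Disjoint P₁ (refl P₁)) (hs : KlShell (P₁ ∪ refl P₁))
    {A B : Finset (Finset (γ₁ ⊕ Fin 4))} (hA : IsUpperSet (A : Set (Finset (γ₁ ⊕ Fin 4)))) (hB : IsUpperSet (B : Set (Finset (γ₁ ⊕ Fin 4)))) :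
    0 ≤ corP (andProd P₁ perfect4) A B :=
  corP_andProd_perfect4_nonneg hP hd (fun U V hU hV => by rw [corP_eq_card_sub_card_of_disjoint hd]; exact hs U V hU hV) hA hB

/-- **`P₁ ∧ perfect4` is an intersecting Kleitman shell** whenever `P₁` is (with `Cor_{P₁} ≥ 0`). [this work] -/
theorem klShell_andProd_perfect4 {P₁ : Finset (Finset γ₁)} (hP : IsUpperSet (P₁ : Set (Finset γ₁))) (hd : Disjoint P₁ (refl P₁))
    (hcor : ∀ U V : Finset (Finset γ₁), IsUpperSet (U : Set (Finset γ₁)) → IsUpperSet (V : Set (Finset γ₁)) → 0 ≤ corP P₁ U V) :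
    KlShell (andProd P₁ perfect4 ∪ refl (andProd P₁ perfect4)) :=
  klShell_of_corP_nonneg (disjoint_andProd_refl hd perfect4) fun _ _ hA hB => corP_andProd_perfect4_nonneg hP hd hcor hA hB

end FiveUpSet

end Summit.CriticalPhenomena.PercolationContinuityZ3.Theorems
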